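import Summits.QuantumFields.YangMills.Theorems.LuscherReductionTwistedTraceScalingMagneticLattice
import Summits.QuantumFields.YangMills.Theorems.LuscherReductionTwistedTraceScalingGaugeAverage
import Literature.MathematicalPhysics.QuantumLattice.HeatKernelGroupGaugeProofs
import HarnessLib

/-!
# The Wilson action as an EXACT function of the plaquette curvature vectors `F_p = vecPart(U_p)`; gauge covariance of `F`
# (lane B of S-BASE, crux `TwistedTraceScaling` stmt-QuantumFields-20203; COVARIANT reformulation of the Laplace step, blueprint §5)

For `SU(2)`, `S(U) = Σ_p (2 − Re tr U_p) = Σ_p 2(1 − u₀(U_p))` and `u₀² + |F_p|² = 1`, so the action is an exact function of the curvature vectors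
`F_p := vecPart(U_p) ∈ ℝ³`: ALWAYS `‖F‖² ≤ S(U)` (`2(1−u₀) − |F|² = (1−u₀)²`), and on `{u₀(U_p) ≥ 0 ∀p}` (in particular near flat connections)
`S(U) ≤ ‖F‖² + Σ_p |F_p|⁴` (`|F|²(1+|F|²) − 2(1−u₀) = u₀(1−u₀)²(2+u₀)`).  Under a gauge transformation `F_p ↦ Ad(g_{x_p})F_p` (a rotation), so `|F_p|`,
`‖F‖` and `S` are invariant, and centre twists do not move any plaquette.  This replaces the chart-based cubic estimate
`…GnomonicMagnetic.abs_wilsonAction_gnomonic_sub_curl_le` (which charges pure-gauge excursions) in the covariant trial state of blueprint §5: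
no cut-off in gauge directions is needed, cut-offs live on the invariant `S`.
HONEST FRAMING: algebra; femto rung R2b1 (stub of a child of a CONDITIONAL route); not a gap, not Clay.
-/

set_option autoImplicit false

noncomputable section

open scoped Matrix BigOperators RealInnerProductSpace
open Literature.MathematicalPhysics.QuantumFieldTheory
open Literature.MathematicalPhysics.QuantumLattice

namespace Summit.QuantumFields.YangMills.Theorems.FemtoTransferGap.TwoLattice.Cov

open Summit.QuantumFields.YangMills.Theorems.FemtoTransferGap
open Summit.QuantumFields.YangMills.Theorems.FemtoTransferGap.TwoLattice
open Summit.QuantumFields.YangMills.Theorems.FemtoTransferGap.TwoLattice.Stiff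

variable {L : ℕ} [NeZero L]

/-! ## §1 The curvature vectors -/

/-- The plaquette holonomy of the plaquette `p = (x; i<j)`. [cite: Wilson1974] -/
abbrev hol (U : GaugeConfig 3 L SU2) (p : Plaquette 3 L) : SU2 := plaquetteHolonomy U p.1 p.2.1.1 p.2.1.2

/-- **Curvature vectors** `F(U) ∈ PlaqSpace L`, `F(U)(p, a) = vecPart(U_p)_a`. [cite: Luscher1983, §3] -/
def plaqCurv (U : GaugeConfig 3 L SU2) : PlaqSpace L := WithLp.toLp 2 fun pa : Plaquette 3 L × Fin 3 => vecPart (hol U pa.1) pa.2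

omit [NeZero L] in
/-- Components. [folklore] -/
@[simp] theorem plaqCurv_apply (U : GaugeConfig 3 L SU2) (p : Plaquette 3 L) (a : Fin 3) : plaqCurv U (p, a) = vecPart (hol U p) a := rfl

/-- `‖F(U)‖² = Σ_p Σ_a vecPart(U_p)_a²`. [folklore] -/
theorem norm_plaqCurv_sq (U : GaugeConfig 3 L SU2) : ‖plaqCurv U‖ ^ 2 = ∑ p : Plaquette 3 L, ∑ a, vecPart (hol U p) a ^ 2 := by
  rw [EuclideanSpace.norm_sq_eq, Fintype.sum_prod_type]
  simp only [plaqCurv_apply, Real.norm_eq_abs, sq_abs]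

omit [NeZero L] in
/-- `Σ_a vecPart(U_p)_a² = 1 − u₀(U_p)²`. [folklore] -/
theorem sum_plaqCurv_sq (U : GaugeConfig 3 L SU2) (p : Plaquette 3 L) : ∑ a, vecPart (hol U p) a ^ 2 = 1 - scalarPart (hol U p) ^ 2 :=
  sum_vecPart_sq _

/-! ## §2 The action as a function of the curvature -/

/-- `S(U) = Σ_p 2(1 − u₀(U_p))`. [cite: Wilson1974] -/
theorem wilsonAction_eq_sum_scalarPart (U : GaugeConfig 3 L SU2) :
    wilsonAction su2Rep U = ∑ p : Plaquette 3 L, 2 * (1 - scalarPart (hol U p)) := by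
  rw [wilsonAction_su2_eq_sum]
  refine Finset.sum_congr rfl fun p _ => ?_
  rw [fundamentalRep_apply, re_trace_eq_two_mul_scalarPart]; ring

omit [NeZero L] in
/-- One plaquette, lower: `|F_p|² ≤ 2(1 − u₀)` (equality up to `(1−u₀)²`). [folklore] -/
theorem sum_vecPart_sq_le_plaqTerm (V : SU2) : ∑ a, vecPart V a ^ 2 ≤ 2 * (1 - scalarPart V) := by
  rw [sum_vecPart_sq]; nlinarith [sq_nonneg (1 - scalarPart V)]

omit [NeZero L] in
/-- One plaquette, upper, on the hemisphere `u₀ ≥ 0`: `2(1 − u₀) ≤ |F_p|²(1 + |F_p|²)`. [folklore] -/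
theorem plaqTerm_le_of_scalarPart_nonneg (V : SU2) (hV : 0 ≤ scalarPart V) :
    2 * (1 - scalarPart V) ≤ (∑ a, vecPart V a ^ 2) * (1 + ∑ a, vecPart V a ^ 2) := by
  rw [sum_vecPart_sq]
  have h1 : scalarPart V ≤ 1 := (abs_le.mp (abs_scalarPart_le V)).2
  nlinarith [mul_nonneg (mul_nonneg hV (sq_nonneg (1 - scalarPart V))) (by linarith : (0 : ℝ) ≤ 2 + scalarPart V)]

/-- ★ **Lower bound, everywhere**: `‖F(U)‖² ≤ S(U)`. [cite: Luscher1983, §3] -/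
theorem norm_plaqCurv_sq_le_wilsonAction (U : GaugeConfig 3 L SU2) : ‖plaqCurv U‖ ^ 2 ≤ wilsonAction su2Rep U := by
  rw [norm_plaqCurv_sq, wilsonAction_eq_sum_scalarPart]
  exact Finset.sum_le_sum fun p _ => sum_vecPart_sq_le_plaqTerm _

/-- ★ **Upper bound near flat connections**: if every plaquette has `u₀(U_p) ≥ 0`, then `S(U) ≤ ‖F(U)‖² + Σ_p |F_p|⁴`. [cite: Luscher1983, §3] -/
theorem wilsonAction_le_of_scalarPart_nonneg (U : GaugeConfig 3 L SU2) (hU : ∀ p : Plaquette 3 L, 0 ≤ scalarPart (hol U p)) :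
    wilsonAction su2Rep U ≤ ‖plaqCurv U‖ ^ 2 + ∑ p : Plaquette 3 L, (∑ a, vecPart (hol U p) a ^ 2) ^ 2 := by
  rw [norm_plaqCurv_sq, wilsonAction_eq_sum_scalarPart, ← Finset.sum_add_distrib]
  refine Finset.sum_le_sum fun p _ => ?_
  have h := plaqTerm_le_of_scalarPart_nonneg _ (hU p)
  nlinarith [h]

/-- The hemisphere condition from smallness of the action: `S(U) < 2 ⇒ u₀(U_p) > 0` for every plaquette (each term `2(1−u₀) ≤ S`). [folklore] -/
theorem scalarPart_hol_pos_of_wilsonAction_lt_two (U : GaugeConfig 3 L SU2) (hS : wilsonAction su2Rep U < 2) (p : Plaquette 3 L) :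
    0 < scalarPart (hol U p) := by
  rw [wilsonAction_eq_sum_scalarPart] at hS
  have hle : 2 * (1 - scalarPart (hol U p)) ≤ ∑ q : Plaquette 3 L, 2 * (1 - scalarPart (hol U q)) :=
    Finset.single_le_sum (f := fun q => 2 * (1 - scalarPart (hol U q)))
      (fun q _ => by have := (abs_le.mp (abs_scalarPart_le (hol U q))).2; linarith) (Finset.mem_univ p)
  have h1 := (abs_le.mp (abs_scalarPart_le (hol U p))).2
  by_contra hneg
  -- `u₀ ≤ 0 ⇒ 2(1 − u₀) ≥ 2 > S`
  have hle0 : scalarPart (hol U p) ≤ 0 := le_of_not_gt hneg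
  linarith

/-- ★ Two-sided on `{S < 2}`: `‖F‖² ≤ S ≤ ‖F‖²·(1 + ‖F‖²)`. [cite: Luscher1983, §3] -/
theorem wilsonAction_le_norm_plaqCurv_sq_mul (U : GaugeConfig 3 L SU2) (hS : wilsonAction su2Rep U < 2) :
    wilsonAction su2Rep U ≤ ‖plaqCurv U‖ ^ 2 * (1 + ‖plaqCurv U‖ ^ 2) := by
  have h := wilsonAction_le_of_scalarPart_nonneg U fun p => (scalarPart_hol_pos_of_wilsonAction_lt_two U hS p).le
  have hq : ∑ p : Plaquette 3 L, (∑ a, vecPart (hol U p) a ^ 2) ^ 2 ≤ (∑ p : Plaquette 3 L, ∑ a, vecPart (hol U p) a ^ 2) ^ 2 := by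
    rw [sq, Finset.sum_mul_sum]
    refine Finset.sum_le_sum fun p _ => ?_
    rw [sq]
    exact Finset.single_le_sum (f := fun q => (∑ a, vecPart (hol U p) a ^ 2) * ∑ a, vecPart (hol U q) a ^ 2)
      (fun q _ => mul_nonneg (Finset.sum_nonneg fun a _ => sq_nonneg _) (Finset.sum_nonneg fun a _ => sq_nonneg _)) (Finset.mem_univ p)
  rw [← norm_plaqCurv_sq] at hq
  nlinarith [h, hq]

/-! ## §3 Gauge covariance and twist invariance -/

omit [NeZero L] in
/-- Under a gauge transformation the holonomy is conjugated at the base point. [cite: Wilson1974] -/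
theorem hol_gaugeTransform (g : Site 3 L → SU2) (U : GaugeConfig 3 L SU2) (p : Plaquette 3 L) :
    hol (gaugeTransform g U) p = g p.1 * hol U p * (g p.1)⁻¹ :=
  plaquetteHolonomy_gaugeTransform g U p.1 _ _

omit [NeZero L] in
/-- ★ **Covariance**: `F_p(U^g) = Ad(g_{x_p}) F_p(U)` (a rotation of `ℝ³`). [cite: Luscher1983, §3] -/
theorem plaqCurv_gaugeTransform (g : Site 3 L → SU2) (U : GaugeConfig 3 L SU2) (p : Plaquette 3 L) (a : Fin 3) :
    plaqCurv (gaugeTransform g U) (p, a) = ((adRot (g p.1)).mulVec (vecPart (hol U p))) a := by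
  rw [plaqCurv_apply, hol_gaugeTransform, vecPart_conj]

omit [NeZero L] in
/-- The scalar parts `u₀(U_p)` are gauge invariant. [folklore] -/
theorem scalarPart_hol_gaugeTransform (g : Site 3 L → SU2) (U : GaugeConfig 3 L SU2) (p : Plaquette 3 L) :
    scalarPart (hol (gaugeTransform g U) p) = scalarPart (hol U p) := by
  rw [hol_gaugeTransform, scalarPart_conj]

omit [NeZero L] in
/-- `|F_p|²` is gauge invariant. [folklore] -/
theorem sum_plaqCurv_sq_gaugeTransform (g : Site 3 L → SU2) (U : GaugeConfig 3 L SU2) (p : Plaquette 3 L) :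
    ∑ a, vecPart (hol (gaugeTransform g U) p) a ^ 2 = ∑ a, vecPart (hol U p) a ^ 2 := by
  rw [sum_vecPart_sq, sum_vecPart_sq, scalarPart_hol_gaugeTransform]

/-- ★ `‖F(U^g)‖ = ‖F(U)‖`. [folklore] -/
theorem norm_plaqCurv_gaugeTransform (g : Site 3 L → SU2) (U : GaugeConfig 3 L SU2) : ‖plaqCurv (gaugeTransform g U)‖ = ‖plaqCurv U‖ := by
  have h : ‖plaqCurv (gaugeTransform g U)‖ ^ 2 = ‖plaqCurv U‖ ^ 2 := by
    rw [norm_plaqCurv_sq, norm_plaqCurv_sq]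
    exact Finset.sum_congr rfl fun p _ => sum_plaqCurv_sq_gaugeTransform g U p
  nlinarith [norm_nonneg (plaqCurv (gaugeTransform g U)), norm_nonneg (plaqCurv U), sq_nonneg (‖plaqCurv (gaugeTransform g U)‖ - ‖plaqCurv U‖)]

omit [NeZero L] in
/-- Centre twists do not move any plaquette holonomy, hence not `F`. [cite: tHooft1979] -/
theorem plaqCurv_twist (k : Fin 3) (U : GaugeConfig 3 L SU2) : plaqCurv (twist k negOne U) = plaqCurv U := by
  ext ⟨p, a⟩
  simp only [plaqCurv_apply, hol]
  rw [plaquetteHolonomy_twist_of_mem_center k negOne_mem_center U p.1 (ne_of_lt p.2.2)]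

/-- ★ The action cut-off `{S ≤ σ}` is gauge and twist invariant (the invariant bulk of blueprint §5). [folklore] -/
theorem actionBulk_invariant (σ : ℝ) :
    (∀ (g : Site 3 L → SU2) (U : GaugeConfig 3 L SU2), U ∈ {V : GaugeConfig 3 L SU2 | wilsonAction su2Rep V ≤ σ} →
        gaugeTransform g U ∈ {V : GaugeConfig 3 L SU2 | wilsonAction su2Rep V ≤ σ}) ∧
      ∀ (k : Fin 3) (U : GaugeConfig 3 L SU2), U ∈ {V : GaugeConfig 3 L SU2 | wilsonAction su2Rep V ≤ σ} →
        twist k negOne U ∈ {V : GaugeConfig 3 L SU2 | wilsonAction su2Rep V ≤ σ} := by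
  refine ⟨fun g U hU => ?_, fun k U hU => ?_⟩
  · simp only [Set.mem_setOf_eq] at hU ⊢
    rwa [wilsonAction_gaugeTransform]
  · simp only [Set.mem_setOf_eq] at hU ⊢
    rwa [wilsonAction_twist_of_mem_center su2Rep k negOne_mem_center]

end Summit.QuantumFields.YangMills.Theorems.FemtoTransferGap.TwoLattice.Cov

end
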